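import Summits.QuantumFields.BalabanUV.Beta.MultiscaleCombesThomasL2Cells
import Summits.QuantumFields.BalabanUV.Beta.MultiscaleDistanceMetric

/-!
# `Summit.QuantumFields.BalabanUV.Beta.MultiscaleCombesThomasL2CellsGraded` — engine file 8: the ONE-PREFACTOR cell-to-cell
# ℓ²-operator bound for the multi-region averaged MODEL operator `levelOp` under the ADDITIVE graded-cell datum:
# `‖1_{cell k}(levelOp)⁻¹1_{cell k′}‖_{ℓ²→ℓ²} ≤ L^A·e^{4dκ}·S_{l_k}²/μ₀·e^{−(κ − log L/R)·d_n(t_k,t_{k′})}` (print's `(L^jη)²` AT THE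
# TARGET) and the twin with `S_{l_{k′}}²` AT THE SOURCE (MODEL; (3.46)₁ ∕ (3.42)-prefactor SHAPE; level-count- and volume-free)

HONEST FRAMING (page 1 of everything in this cell).  Discharging `FlowStep.BetaPertH` would make Bałaban's ultraviolet
stability UNCONDITIONAL — a constructive-QFT result; it is NOT the continuum limit and NOT the Clay problem.  This module
discharges nothing of `BetaPertH`; it is [folklore] finite-dimensional bookkeeping, kernel-checked, written by the OWNER of binder
row D4 (unit `b2b-balaban-beta-an4`, gen 44) once co-owner beta-d4-p2-g8's ADDITIVE-grading repair had landed
(`MultiscaleDistanceGraded` v1.1 p232829 §4, answering t4-ne9-formalise-leaf-04-g28's objection O-ne9leaf04g28-1 «RIGID GRADING»: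
the bondwise clause of §2 forces constant scales on a connected graph, the additive two-point datum does not).  It also folds the
co-owner's O-1 footnote (journal l.20047): the MODEL supplier of the scale-transfer hypothesis of engine file 5's
`MultiscaleCombesThomasL2.prefactor_transfer` is `MultiscaleDistanceGraded.scale_le_scale_mul_exp_add` (constant `C = L^A`), NOT
the §2 bondwise lemma named in file 7's header — see `scaleTransfer_of_additive` below, which is exactly that supply in file 5's
currency.  HONEST DEPENDENCY: continuum YM on T⁴ ⇐ BetaPertH ∧ nine spine estimates (0/9 proved); BetaPertH ⇐ (D1) ∧ (D4) ∧
CAP+tail; G-an2-4 gates asym, D1 and NE2/3/4.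

WHAT IS CERTIFIED (kernel, 0 sorry), in the analytic setting of `MultiscaleDecay.hc_levelOp` (pv21's `levelOp` on the torus `UT N`,
isometric bond matrices and level transports, a pairwise-disjoint COVERING cube family — cell `k` of level `l_k`, side `S_{l_k}`,
corner `t_k = ctrU (zc k)` —, print-size weights from above, `|c| ≤ c_max`, cell-sum coercivity `C`, rate `0 ≤ κ ≤ 1`,
`μ₀ = C − 2d·c_max²κ² − a_max(e^{2dκ} − 1) > 0`), writing `D = d_n(t_k,t_{k′})` for (K)'s scale-adapted distance of the corners and
`‖·‖_k` for the ℓ²-norm over cell `k`: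
* §1 `siteScale_ctrU` — the corner of cell `k` has site scale `S_{l_k}`;
* §2 **`real_cellNorm_levelOp_inverse_le_explicit`** — file 7's bound in closed form:
  `‖(levelOp)⁻¹u‖_k ≤ e^{4dκ}·(S_{l_k}S_{l_{k′}}/μ₀)·e^{−κD}·‖u‖_{k′}` for `u` supported in cell `k′` (the geometric-mean prefactor);
* §3 **`scaleTransfer_of_additive`** — on ANY bond structure with graded scales `n = L^e` (`1 ≤ L`): the additive datum
  `|e(x) − e(y)| ≤ A + d_n(x,y)/R` gives `e^{−(log L/R)·d_n(x,y)}·√((μ₀n(x)⁻²)/(μ₀n(y)⁻²)) ≤ L^A` — the hypothesis `hst` of file 5's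
  `prefactor_transfer` ∕ `set_norm_inv_le_onePrefactor` with `ακ = log L/R`, `C = L^A` (the O-1 footnote in kernel form);
* §4 **`real_cellNorm_levelOp_inverse_le_graded`** — graded level sides `S_l = L^{e_l}` and the additive datum ON THE TWO CELLS
  `|e_{l_k} − e_{l_{k′}}| ≤ A + D/R` give `‖(levelOp)⁻¹u‖_k ≤ L^A·e^{4dκ}·(S_{l_k}²/μ₀)·e^{−(κ − log L/R)·D}·‖u‖_{k′}` — ONE prefactor, the
  TARGET cell's squared side (print's `(L^jη)²`, `y ∈ Λ_j` the target localisation), at the rate cost `log L/R`;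
* §5 **`real_cellNorm_levelOp_inverse_le_graded_source`** — the same with the SOURCE cell's squared side `S_{l_{k′}}²`
  (print p. 398: «the choice of powers `L^jη` is conventional … we may replace the factor `(L^jη)^α` by `(L^jη)^β(L^{j′}η)^γ` with
  `β + γ = α`» — here the two endpoint cases `(β,γ) = (2,0), (0,2)`; `d_n` is symmetric by beta-d4-p2's `sdist_comm`).
Constants see `d, c, a, C, κ, L, A, R` only — neither the sides, nor the levels or their number, nor the volume, and no `#cell`
factor.  Ingredients BY NAME, nothing restated: file 7 `MultiscaleCombesThomasL2Cells.real_cellNorm_levelOp_inverse_le` (p232911),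
`MultiscaleDistanceGraded.scale_le_scale_mul_exp_add` ∕ `prefactor_exchange_add` (beta-d4-p2, p232829),
`MultiscaleDistanceMetric.sdist_comm` (beta-d4-p2, p232539), `MultiscaleDecayBudget.siteScale_cellPt`,
`MultiscaleCoerciveTorus.cubePt_zero`.

WHAT IS NOT HERE.  The additive datum is a HYPOTHESIS ON DATA (the SHAPE of [B6] (2.1)–(2.2)'s step geometry: one level change per
`≍ R = RM` units of `d_n`, `A = 1`); nothing of print's region sequence `{Ω_j}` is constructed.  The bound is the ℓ² → ℓ² member's
shape ((3.46)₁); the sup-norm member (3.42) «|(G′(U)λ)(x)| ≦ B₀(L^jη)²e^{−δ₀d(y,y′)}|λ|» is an ℓ^∞ → ℓ^∞ LOCALIZED OPERATOR bound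
(|λ| the supremum norm (3.39)) whose level-free prefactor is the LOCAL REGULARITY content of O.2 item (ii-b) — the generic passage
from the ℓ² member costs `√#Δ(y′)`; it is NOT here.  No Dirichlet holes (the `dirInv` twin goes through beta-d4-p2's
`MultiscaleDecayDirichlet.hc_sandwich` the same way), nothing of Bałaban's `U`, `Ū`, vector operators.  Row D4: NO class change
(critical-path width 0; D4 DISCHARGE NO DATE); NOT BetaPertH, NOT continuum, NOT Clay, NOT summit progress.

LOCATORS (shape only, nothing printed asserted; ABSOLUTE RULE): [Balaban1985BackgroundPropagators] Thm 3.1 (3.42) p. 397, (3.46)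
and the «conventional powers» remark p. 398 (renders read as images, gen 44); [Balaban1984PropagatorsII] (2.1)–(2.2) p. 224, (2.46)
p. 231, Lemma 2.1 (2.60) p. 234.
-/

open scoped BigOperators
open Finset

namespace Summit.QuantumFields.BalabanUV.Beta.MultiscaleCombesThomasL2CellsGraded

open Summit.QuantumFields.BalabanUV.Beta.MultiscaleCombesThomasL2Cells (real_cellNorm_levelOp_inverse_le)
open Summit.QuantumFields.BalabanUV.Beta.BoxPoincare (Box)
open Summit.QuantumFields.BalabanUV.Beta.MultiscaleCoerciveTorus
open Summit.QuantumFields.BalabanUV.Beta.MultiscaleDistance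
open Summit.QuantumFields.BalabanUV.Beta.MultiscaleDistanceGraded (scale_le_scale_mul_exp_add prefactor_exchange_add)
open Summit.QuantumFields.BalabanUV.Beta.MultiscaleDistanceMetric (sdist_comm)
open Summit.QuantumFields.BalabanUV.Beta.MultiscaleDecayBudget
open Summit.QuantumFields.BalabanUV.Beta.MultiscaleDecay (hc_levelOp decay_levelOp)
open Literature.MathematicalPhysics.QuantumFieldTheory.Balaban1983to89
open Literature.MathematicalPhysics.QuantumFieldTheory.Balaban1983to89.B9Thm37GluePU (bsrc btgt)
open Literature.MathematicalPhysics.QuantumFieldTheory.Balaban1983to89.B9Thm37GlueTorusCov (tblk)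
open Literature.MathematicalPhysics.QuantumFieldTheory.Balaban1983to89.B9Thm37GlueTorusCovLevels (levelOp)
open B5TorusCover (UT Ctr ctrU)

noncomputable section

/-! ## §3 (stated first, no torus) The scale-transfer hypothesis of file 5 from the ADDITIVE datum -/

section Additive

variable {St Bd : Type} (src tgt : Bd → St) (n : St → ℕ)

/-- **THE O-1 FOOTNOTE IN KERNEL FORM.**  Graded scales `n = L^e`, `1 ≤ L`, and the additive two-point datum
`|e(x) − e(y)| ≤ A + d_n(x,y)/R` give, for every `μ₀ > 0`,
`e^{−((log L/R)·d_n(x,y))}·√((μ₀·n(x)⁻²)/(μ₀·n(y)⁻²)) ≤ L^A` — i.e. the hypothesis `hst` of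
`MultiscaleCombesThomasL2.prefactor_transfer` for the sitewise profile floors `ν = μ₀n(x)⁻²` (target), `ν′ = μ₀n(y)⁻²` (source), with
`α·κ = log L/R` and `C = L^A` (`√(ν/ν′) = n(y)/n(x) ≤ L^A·e^{(log L/R)d_n(x,y)}` is `scale_le_scale_mul_exp_add`).
[cite: Balaban1984PropagatorsII, Lemma 2.1 (2.60) p.234 + (2.1)-(2.2) p.224] [folklore] -/
theorem scaleTransfer_of_additive {L : ℕ} (hL : 1 ≤ L) (e : St → ℕ) (hn : ∀ x, n x = L ^ e x) {R : ℝ} {A : ℕ} {μ₀ : ℝ}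
    (hμ₀ : 0 < μ₀) {x y : St} (hadd : |(e x : ℝ) - e y| ≤ A + sdist src tgt n x y / R) :
    Real.exp (-(Real.log L / R * sdist src tgt n x y)) *
        Real.sqrt (μ₀ * ((n x : ℝ) ^ 2)⁻¹ / (μ₀ * ((n y : ℝ) ^ 2)⁻¹)) ≤ (L : ℝ) ^ A := by
  have hL0 : (0 : ℝ) < L := by exact_mod_cast hL
  have hnpos : ∀ z, (0 : ℝ) < n z := fun z => by
    rw [hn z]; exact_mod_cast pow_pos (by omega : 0 < L) (e z)
  have hx := hnpos x
  have hy := hnpos y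
  -- `√(ν/ν′) = n(y)/n(x)`
  have hratio : Real.sqrt (μ₀ * ((n x : ℝ) ^ 2)⁻¹ / (μ₀ * ((n y : ℝ) ^ 2)⁻¹)) = (n y : ℝ) / n x := by
    have : μ₀ * ((n x : ℝ) ^ 2)⁻¹ / (μ₀ * ((n y : ℝ) ^ 2)⁻¹) = ((n y : ℝ) / n x) ^ 2 := by
      field_simp
    rw [this, Real.sqrt_sq (div_nonneg hy.le hx.le)]
  rw [hratio]
  have hscale := scale_le_scale_mul_exp_add src tgt n hL e hn (A := A) hadd
  -- `e^{−tD}·(n y / n x) ≤ L^A` ⟸ `n y ≤ L^A · n x · e^{tD}`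
  have hexp0 : 0 < Real.exp (Real.log L / R * sdist src tgt n x y) := Real.exp_pos _
  rw [Real.exp_neg]
  rw [inv_mul_le_iff₀ hexp0, div_le_iff₀ hx]
  calc (n y : ℝ) ≤ (L : ℝ) ^ A * n x * Real.exp (Real.log L / R * sdist src tgt n x y) := hscale
    _ = Real.exp (Real.log L / R * sdist src tgt n x y) * (L : ℝ) ^ A * n x := by ring

end Additive

variable {d : ℕ} {N : Fin d → ℕ} [∀ i, NeZero (N i)] [NeZero d] {Cp J K : Type} [Fintype Cp] [DecidableEq Cp] [Nonempty Cp]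
  [Fintype J] [Fintype K] [DecidableEq K] (S : J → ℕ) (hS : ∀ l, 1 ≤ S l) (hdivS : ∀ l i, S l ∣ N i) (lvl : K → J)
  (zc : (k : K) → Ctr N (S (lvl k)))

/-! ## §1 The corner of a cell has the cell's scale -/

omit [NeZero d] [Fintype Cp] [DecidableEq Cp] [Nonempty Cp] [Fintype J] [Fintype K] [DecidableEq K] in
/-- The corner `t_k = ctrU (zc k)` is the chart point of cell `k` at offset `0`, so `n(t_k) = S_{l_k}` (`cubePt_zero` +
`siteScale_cellPt`). [folklore] -/
theorem siteScale_ctrU (hdisj : ∀ k k' v v', cellPt S hS hdivS lvl zc k v = cellPt S hS hdivS lvl zc k' v' → k = k')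
    (hcover : ∀ x : UT N, ∃ k, ∃ v : Box d (S (lvl k)), cellPt S hS hdivS lvl zc k v = x) (k : K) :
    siteScale S hS hdivS lvl zc hcover (ctrU N (S (lvl k)) (zc k)) = S (lvl k) := by
  have h : ctrU N (S (lvl k)) (zc k) = cellPt S hS hdivS lvl zc k (fun _ => ⟨0, hS (lvl k)⟩) :=
    (cubePt_zero (hS (lvl k)) (hdivS (lvl k)) (zc k)).symm
  rw [h, siteScale_cellPt S hS hdivS lvl zc hdisj hcover]

/-! ## The analytic setting of `MultiscaleDecay.hc_levelOp`, as section variables (as in file 7 and K4 §6) -/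

variable
    (hdisj : ∀ k k' v v', cellPt S hS hdivS lvl zc k v = cellPt S hS hdivS lvl zc k' v' → k = k')
    (hcover : ∀ x : UT N, ∃ k, ∃ v : Box d (S (lvl k)), cellPt S hS hdivS lvl zc k v = x)
    (Rm : UT N × Fin d → Cp → Cp → ℝ) (hRm : ∀ b i j, ∑ k, Rm b k i * Rm b k j = if i = j then (1 : ℝ) else 0)
    (T : J → UT N → Cp → Cp → ℝ) (hT : ∀ l x i i', ∑ k, T l x k i * T l x k i' = if i = i' then (1 : ℝ) else 0)
    (a : J → ℝ) (ha : ∀ j, 0 ≤ a j) (ω : J → UT N → ℝ)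
    (hsupp : ∀ l x, ω l (ctrU N (S l) (tblk (hS l) (hdivS l) x)) ≠ 0 → ∃ k v, lvl k = l ∧ cellPt S hS hdivS lvl zc k v = x)
    {amax : ℝ} (hamax : 0 ≤ amax)
    (hscale : ∀ k, a (lvl k) * ω (lvl k) (ctrU N (S (lvl k)) (zc k)) ^ 2 * (S (lvl k) : ℝ) ^ d ≤ amax / (S (lvl k) : ℝ) ^ 2)
    (c : UT N × Fin d → ℝ) {cmax : ℝ} (hc : ∀ b, |c b| ≤ cmax) {C : ℝ}
    (hcoer : ∀ f : UT N × Cp → ℝ,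
      C * ∑ k, ((S (lvl k) : ℝ) ^ 2)⁻¹ * ∑ v : Box d (S (lvl k)), ∑ i, f (cellPt S hS hdivS lvl zc k v, i) ^ 2 ≤
        ∑ p, f p * levelOp bsrc btgt c Rm (fun l x => ctrU N (S l) (tblk (hS l) (hdivS l) x))
          (fun l x => ω l (ctrU N (S l) (tblk (hS l) (hdivS l) x))) T a f p)
    {κ : ℝ} (hκ0 : 0 ≤ κ) (hκ1 : κ ≤ 1)

include hdisj hRm hT ha hsupp hamax hscale hc hcoer hκ0 hκ1

/-! ## §2 File 7's bound in closed form (the geometric-mean prefactor) -/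

/-- **THE CELL-TO-CELL BOUND IN CLOSED FORM.**  For cells `k, k′` and a real `u` supported in cell `k′`:
`√(Σ_{p ∈ cell k}((levelOp)⁻¹u)_p²) ≤ e^{4dκ}·(S_{l_k}S_{l_{k′}}/μ₀)·e^{−κ·d_n(t_k,t_{k′})}·√(Σ_{p ∈ cell k′}u_p²)`,
`μ₀ = C − 2d·c_max²κ² − a_max(e^{2dκ} − 1) > 0` — file 7's `real_cellNorm_levelOp_inverse_le` with
`√((μ₀S_{l_k}⁻²)(μ₀S_{l_{k′}}⁻²)) = μ₀/(S_{l_k}S_{l_{k′}})` and `e^{−κ(D − 2d − 2d)} = e^{4dκ}e^{−κD}` carried out.  In words: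
`‖1_{cell k}(levelOp)⁻¹1_{cell k′}‖_{ℓ²→ℓ²} ≤ e^{4dκ}·S_{l_k}S_{l_{k′}}/μ₀·e^{−κ d_n(t_k,t_{k′})}`, the (3.46)₁ SHAPE with the
geometric-mean local prefactor. [cite: Balaban1985BackgroundPropagators, Thm 3.1 (3.46) p.398] [folklore] -/
theorem real_cellNorm_levelOp_inverse_le_explicit (hμ : 0 < C - 2 * d * cmax ^ 2 * κ ^ 2 - amax * (Real.exp (2 * d * κ) - 1))
    (k k' : K) (u : UT N × Cp → ℝ) (hu : ∀ p, cellOf S hS hdivS lvl zc hcover p.1 ≠ k' → u p = 0) :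
    Real.sqrt (∑ p ∈ univ.filter (fun p : UT N × Cp => cellOf S hS hdivS lvl zc hcover p.1 = k),
        (Ring.inverse (levelOp bsrc btgt c Rm (fun l x => ctrU N (S l) (tblk (hS l) (hdivS l) x))
          (fun l x => ω l (ctrU N (S l) (tblk (hS l) (hdivS l) x))) T a)) u p ^ 2) ≤
      Real.exp (4 * d * κ) *
        ((S (lvl k) : ℝ) * (S (lvl k') : ℝ) / (C - 2 * d * cmax ^ 2 * κ ^ 2 - amax * (Real.exp (2 * d * κ) - 1))) *
        Real.exp (-(κ * sdist bsrc btgt (siteScale S hS hdivS lvl zc hcover) (ctrU N (S (lvl k)) (zc k))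
          (ctrU N (S (lvl k')) (zc k')))) *
        Real.sqrt (∑ p ∈ univ.filter (fun p : UT N × Cp => cellOf S hS hdivS lvl zc hcover p.1 = k'), u p ^ 2) := by
  have h7 := real_cellNorm_levelOp_inverse_le S hS hdivS lvl zc hdisj hcover Rm hRm T hT a ha ω hsupp hamax hscale c hc hcoer
    hκ0 hκ1 hμ k k' u hu
  refine h7.trans (le_of_eq ?_)
  set μ₀ := C - 2 * d * cmax ^ 2 * κ ^ 2 - amax * (Real.exp (2 * d * κ) - 1) with hμ₀
  set D := sdist bsrc btgt (siteScale S hS hdivS lvl zc hcover) (ctrU N (S (lvl k)) (zc k)) (ctrU N (S (lvl k')) (zc k'))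
    with hD
  have hSk : (0 : ℝ) < S (lvl k) := by exact_mod_cast hS (lvl k)
  have hSk' : (0 : ℝ) < S (lvl k') := by exact_mod_cast hS (lvl k')
  -- the square root of the product of the two floors
  have hsq : Real.sqrt (μ₀ * ((S (lvl k) : ℝ) ^ 2)⁻¹ * (μ₀ * ((S (lvl k') : ℝ) ^ 2)⁻¹)) =
      μ₀ / ((S (lvl k) : ℝ) * (S (lvl k') : ℝ)) := by
    have : μ₀ * ((S (lvl k) : ℝ) ^ 2)⁻¹ * (μ₀ * ((S (lvl k') : ℝ) ^ 2)⁻¹) = (μ₀ / ((S (lvl k) : ℝ) * (S (lvl k') : ℝ))) ^ 2 := by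
      field_simp
    rw [this, Real.sqrt_sq (div_nonneg hμ.le (mul_nonneg hSk.le hSk'.le))]
  -- the exponential
  have hexp : Real.exp (-(κ * (D - 2 * d - 2 * d))) = Real.exp (4 * d * κ) * Real.exp (-(κ * D)) := by
    rw [← Real.exp_add]; congr 1; ring
  rw [hsq, hexp]
  congr 1
  field_simp

/-! ## §4 One prefactor at the TARGET under the additive graded-cell datum -/

/-- **THE ONE-PREFACTOR CELL-TO-CELL BOUND (TARGET).**  Graded level sides `S_l = L^{e_l}` (`1 ≤ L`) and the additive datum on
the two cells `|e_{l_k} − e_{l_{k′}}| ≤ A + d_n(t_k,t_{k′})/R`; then for a real `u` supported in cell `k′`: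
`√(Σ_{p ∈ cell k}((levelOp)⁻¹u)_p²) ≤ L^A·e^{4dκ}·(S_{l_k}²/μ₀)·e^{−(κ − log L/R)·d_n(t_k,t_{k′})}·√(Σ_{p ∈ cell k′}u_p²)` — i.e.
`‖1_{cell k}(levelOp)⁻¹1_{cell k′}‖_{ℓ²→ℓ²} ≤ L^A·e^{4dκ}·S_{l_k}²/μ₀·e^{−(κ − log L/R)d_n(t_k,t_{k′})}`: print's ONE prefactor
`(L^jη)²` of the TARGET localisation `y ∈ Λ_j`, at the rate cost `log L/R` (print: `R ≍ RM` large, `L^A = L` into `B₀`); §2 +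
beta-d4-p2's `prefactor_exchange_add` at `x = t_k`, `y = t_{k′}` + §1.
[cite: Balaban1985BackgroundPropagators, Thm 3.1 (3.42) p.397 + (3.46) p.398; Balaban1984PropagatorsII, (2.1)-(2.2) p.224] [folklore] -/
theorem real_cellNorm_levelOp_inverse_le_graded (hμ : 0 < C - 2 * d * cmax ^ 2 * κ ^ 2 - amax * (Real.exp (2 * d * κ) - 1))
    {L : ℕ} (hL : 1 ≤ L) (e : J → ℕ) (hSe : ∀ l, S l = L ^ e l) {R : ℝ} {A : ℕ} (k k' : K)
    (hadd : |(e (lvl k) : ℝ) - e (lvl k')| ≤ A + sdist bsrc btgt (siteScale S hS hdivS lvl zc hcover)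
      (ctrU N (S (lvl k)) (zc k)) (ctrU N (S (lvl k')) (zc k')) / R)
    (u : UT N × Cp → ℝ) (hu : ∀ p, cellOf S hS hdivS lvl zc hcover p.1 ≠ k' → u p = 0) :
    Real.sqrt (∑ p ∈ univ.filter (fun p : UT N × Cp => cellOf S hS hdivS lvl zc hcover p.1 = k),
        (Ring.inverse (levelOp bsrc btgt c Rm (fun l x => ctrU N (S l) (tblk (hS l) (hdivS l) x))
          (fun l x => ω l (ctrU N (S l) (tblk (hS l) (hdivS l) x))) T a)) u p ^ 2) ≤
      (L : ℝ) ^ A * Real.exp (4 * d * κ) *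
        ((S (lvl k) : ℝ) ^ 2 / (C - 2 * d * cmax ^ 2 * κ ^ 2 - amax * (Real.exp (2 * d * κ) - 1))) *
        Real.exp (-((κ - Real.log L / R) * sdist bsrc btgt (siteScale S hS hdivS lvl zc hcover) (ctrU N (S (lvl k)) (zc k))
          (ctrU N (S (lvl k')) (zc k')))) *
        Real.sqrt (∑ p ∈ univ.filter (fun p : UT N × Cp => cellOf S hS hdivS lvl zc hcover p.1 = k'), u p ^ 2) := by
  have h2 := real_cellNorm_levelOp_inverse_le_explicit S hS hdivS lvl zc hdisj hcover Rm hRm T hT a ha ω hsupp hamax hscale c hc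
    hcoer hκ0 hκ1 hμ k k' u hu
  refine h2.trans ?_
  set μ₀ := C - 2 * d * cmax ^ 2 * κ ^ 2 - amax * (Real.exp (2 * d * κ) - 1) with hμ₀
  set n := siteScale S hS hdivS lvl zc hcover with hn
  set tk : UT N := ctrU N (S (lvl k)) (zc k) with htk
  set tk' : UT N := ctrU N (S (lvl k')) (zc k') with htk'
  -- the grading of the site scale: `n = L^(e ∘ lvl ∘ cellOf)`
  have hgr : ∀ x, n x = L ^ (e (lvl (cellOf S hS hdivS lvl zc hcover x))) := fun x => by rw [hn, siteScale, hSe]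
  -- the two corners have scales `S_{l_k}`, `S_{l_{k′}}`
  have hk : cellOf S hS hdivS lvl zc hcover tk = k := by
    rw [htk, ← cubePt_zero (hS (lvl k)) (hdivS (lvl k)) (zc k)]
    exact cellOf_cellPt S hS hdivS lvl zc hdisj hcover k _
  have hk' : cellOf S hS hdivS lvl zc hcover tk' = k' := by
    rw [htk', ← cubePt_zero (hS (lvl k')) (hdivS (lvl k')) (zc k')]
    exact cellOf_cellPt S hS hdivS lvl zc hdisj hcover k' _
  have hntk : (n tk : ℝ) = S (lvl k) := by rw [hn, htk, siteScale_ctrU S hS hdivS lvl zc hdisj hcover k]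
  have hntk' : (n tk' : ℝ) = S (lvl k') := by rw [hn, htk', siteScale_ctrU S hS hdivS lvl zc hdisj hcover k']
  -- the additive datum at the two corners, in the site grading
  have hadd' : |((e (lvl (cellOf S hS hdivS lvl zc hcover tk)) : ℕ) : ℝ) - (e (lvl (cellOf S hS hdivS lvl zc hcover tk')) : ℕ)| ≤
      A + sdist bsrc btgt n tk tk' / R := by
    rw [hk, hk']; exact hadd
  -- beta-d4-p2's additive prefactor exchange at `x = t_k`, `y = t_{k′}`
  have hex := prefactor_exchange_add bsrc btgt n hL (fun x => e (lvl (cellOf S hS hdivS lvl zc hcover x))) hgr κ hadd'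
  rw [hntk, hntk'] at hex
  -- assemble
  have hsqrt0 : 0 ≤ Real.sqrt (∑ p ∈ univ.filter (fun p : UT N × Cp => cellOf S hS hdivS lvl zc hcover p.1 = k'), u p ^ 2) :=
    Real.sqrt_nonneg _
  refine mul_le_mul_of_nonneg_right ?_ hsqrt0
  have hE0 : 0 ≤ Real.exp (4 * d * κ) := (Real.exp_pos _).le
  calc Real.exp (4 * d * κ) * ((S (lvl k) : ℝ) * (S (lvl k') : ℝ) / μ₀) * Real.exp (-(κ * sdist bsrc btgt n tk tk'))
      = Real.exp (4 * d * κ) / μ₀ * (Real.exp (-(κ * sdist bsrc btgt n tk tk')) * ((S (lvl k) : ℝ) * (S (lvl k') : ℝ))) := by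
        ring
    _ ≤ Real.exp (4 * d * κ) / μ₀ *
          ((L : ℝ) ^ A * Real.exp (-((κ - Real.log L / R) * sdist bsrc btgt n tk tk')) * (S (lvl k) : ℝ) ^ 2) :=
        mul_le_mul_of_nonneg_left hex (div_nonneg hE0 hμ.le)
    _ = (L : ℝ) ^ A * Real.exp (4 * d * κ) * ((S (lvl k) : ℝ) ^ 2 / μ₀) *
          Real.exp (-((κ - Real.log L / R) * sdist bsrc btgt n tk tk')) := by ring

/-! ## §5 One prefactor at the SOURCE («the choice of powers is conventional») -/

/-- **THE ONE-PREFACTOR CELL-TO-CELL BOUND (SOURCE).**  Same hypotheses as §4; the prefactor may be put on the SOURCE cell instead: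
`√(Σ_{p ∈ cell k}((levelOp)⁻¹u)_p²) ≤ L^A·e^{4dκ}·(S_{l_{k′}}²/μ₀)·e^{−(κ − log L/R)·d_n(t_k,t_{k′})}·√(Σ_{p ∈ cell k′}u_p²)` — §2 +
`prefactor_exchange_add` at `x = t_{k′}`, `y = t_k` + `sdist_comm`.  Print p. 398: «the choice of powers `L^jη` is conventional
also. Using Lemma 2.1 in [4] we may replace the factor `(L^jη)^α` by `(L^jη)^β(L^{j′}η)^γ` with `β + γ = α`».
[cite: Balaban1985BackgroundPropagators, Thm 3.1 (3.46) + remark p.398; Balaban1984PropagatorsII, Lemma 2.1 (2.60) p.234] [folklore] -/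
theorem real_cellNorm_levelOp_inverse_le_graded_source
    (hμ : 0 < C - 2 * d * cmax ^ 2 * κ ^ 2 - amax * (Real.exp (2 * d * κ) - 1))
    {L : ℕ} (hL : 1 ≤ L) (e : J → ℕ) (hSe : ∀ l, S l = L ^ e l) {R : ℝ} {A : ℕ} (k k' : K)
    (hadd : |(e (lvl k) : ℝ) - e (lvl k')| ≤ A + sdist bsrc btgt (siteScale S hS hdivS lvl zc hcover)
      (ctrU N (S (lvl k)) (zc k)) (ctrU N (S (lvl k')) (zc k')) / R)
    (u : UT N × Cp → ℝ) (hu : ∀ p, cellOf S hS hdivS lvl zc hcover p.1 ≠ k' → u p = 0) :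
    Real.sqrt (∑ p ∈ univ.filter (fun p : UT N × Cp => cellOf S hS hdivS lvl zc hcover p.1 = k),
        (Ring.inverse (levelOp bsrc btgt c Rm (fun l x => ctrU N (S l) (tblk (hS l) (hdivS l) x))
          (fun l x => ω l (ctrU N (S l) (tblk (hS l) (hdivS l) x))) T a)) u p ^ 2) ≤
      (L : ℝ) ^ A * Real.exp (4 * d * κ) *
        ((S (lvl k') : ℝ) ^ 2 / (C - 2 * d * cmax ^ 2 * κ ^ 2 - amax * (Real.exp (2 * d * κ) - 1))) *
        Real.exp (-((κ - Real.log L / R) * sdist bsrc btgt (siteScale S hS hdivS lvl zc hcover) (ctrU N (S (lvl k)) (zc k))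
          (ctrU N (S (lvl k')) (zc k')))) *
        Real.sqrt (∑ p ∈ univ.filter (fun p : UT N × Cp => cellOf S hS hdivS lvl zc hcover p.1 = k'), u p ^ 2) := by
  have h2 := real_cellNorm_levelOp_inverse_le_explicit S hS hdivS lvl zc hdisj hcover Rm hRm T hT a ha ω hsupp hamax hscale c hc
    hcoer hκ0 hκ1 hμ k k' u hu
  refine h2.trans ?_
  set μ₀ := C - 2 * d * cmax ^ 2 * κ ^ 2 - amax * (Real.exp (2 * d * κ) - 1) with hμ₀
  set n := siteScale S hS hdivS lvl zc hcover with hn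
  set tk : UT N := ctrU N (S (lvl k)) (zc k) with htk
  set tk' : UT N := ctrU N (S (lvl k')) (zc k') with htk'
  have hgr : ∀ x, n x = L ^ (e (lvl (cellOf S hS hdivS lvl zc hcover x))) := fun x => by rw [hn, siteScale, hSe]
  have hk : cellOf S hS hdivS lvl zc hcover tk = k := by
    rw [htk, ← cubePt_zero (hS (lvl k)) (hdivS (lvl k)) (zc k)]
    exact cellOf_cellPt S hS hdivS lvl zc hdisj hcover k _
  have hk' : cellOf S hS hdivS lvl zc hcover tk' = k' := by
    rw [htk', ← cubePt_zero (hS (lvl k')) (hdivS (lvl k')) (zc k')]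
    exact cellOf_cellPt S hS hdivS lvl zc hdisj hcover k' _
  have hntk : (n tk : ℝ) = S (lvl k) := by rw [hn, htk, siteScale_ctrU S hS hdivS lvl zc hdisj hcover k]
  have hntk' : (n tk' : ℝ) = S (lvl k') := by rw [hn, htk', siteScale_ctrU S hS hdivS lvl zc hdisj hcover k']
  -- symmetry of `d_n` (beta-d4-p2's `sdist_comm`, no hypothesis)
  have hsym : sdist bsrc btgt n tk' tk = sdist bsrc btgt n tk tk' := sdist_comm bsrc btgt n tk' tk
  -- the additive datum read from the source: `|e(t_{k′}) − e(t_k)| ≤ A + d_n(t_{k′},t_k)/R`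
  have hadd' : |((e (lvl (cellOf S hS hdivS lvl zc hcover tk')) : ℕ) : ℝ) - (e (lvl (cellOf S hS hdivS lvl zc hcover tk)) : ℕ)| ≤
      A + sdist bsrc btgt n tk' tk / R := by
    rw [hk, hk', hsym, abs_sub_comm]; exact hadd
  have hex := prefactor_exchange_add bsrc btgt n hL (fun x => e (lvl (cellOf S hS hdivS lvl zc hcover x))) hgr κ hadd'
  rw [hntk, hntk', hsym] at hex
  have hsqrt0 : 0 ≤ Real.sqrt (∑ p ∈ univ.filter (fun p : UT N × Cp => cellOf S hS hdivS lvl zc hcover p.1 = k'), u p ^ 2) :=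
    Real.sqrt_nonneg _
  refine mul_le_mul_of_nonneg_right ?_ hsqrt0
  have hE0 : 0 ≤ Real.exp (4 * d * κ) := (Real.exp_pos _).le
  calc Real.exp (4 * d * κ) * ((S (lvl k) : ℝ) * (S (lvl k') : ℝ) / μ₀) * Real.exp (-(κ * sdist bsrc btgt n tk tk'))
      = Real.exp (4 * d * κ) / μ₀ * (Real.exp (-(κ * sdist bsrc btgt n tk tk')) * ((S (lvl k') : ℝ) * (S (lvl k) : ℝ))) := by
        ring
    _ ≤ Real.exp (4 * d * κ) / μ₀ *
          ((L : ℝ) ^ A * Real.exp (-((κ - Real.log L / R) * sdist bsrc btgt n tk tk')) * (S (lvl k') : ℝ) ^ 2) :=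
        mul_le_mul_of_nonneg_left hex (div_nonneg hE0 hμ.le)
    _ = (L : ℝ) ^ A * Real.exp (4 * d * κ) * ((S (lvl k') : ℝ) ^ 2 / μ₀) *
          Real.exp (-((κ - Real.log L / R) * sdist bsrc btgt n tk tk')) := by ring

end

end Summit.QuantumFields.BalabanUV.Beta.MultiscaleCombesThomasL2CellsGraded
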